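import Summits.QuantumAdvantage.QuantumAdvantage.Theses.MobiusLadder
import Literature.NumberTheory.Sieve.MoebiusWalshCircuitsGreenProofs

/-!
# Route `MobiusLadder`, item `AC0Rung` (stmt-QuantumAdvantage-1395)

The support item `AC0Rung : WalshLiouvilleBound → LiouvilleOrthogonalAC0` of route
`QuantumAdvantage/MobiusLadder` (rung R0 of the ladder): a UNIFORM Walsh bound for the Liouville
function, `|Σ_{N<2ⁿ} λ(N) w_S(bits N)| ≤ 2^{n − n^c}` for all `S ⊆ {0,…,n−1}` and all large `n`
(Bourgain 2013, Theorem 1, Liouville form; the route's first crux `WalshLiouvilleBound`), implies that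
`λ` is asymptotically orthogonal to every polynomial-size `AC⁰` function of the binary digits
(`LiouvilleOrthogonalAC0`, the "Möbius randomness for `AC⁰`" predicate in the tree's conventions:
`Circuit.acDepth`, negations free, size `≤ p(n)`, `ε`-form eventually in `n`).

## The argument (Green 2012, §2, with a uniform hypothesis)

Proved once for an arbitrary bounded sequence `g : ℕ → ℝ`, `|g| ≤ 1`
(`ac0_orthogonal_of_uniform_walsh`), then specialised to `g = λ` (`AC0Rung_proof`).
Expand `Σ_y G(y) F(y)` (`G = g ∘ val`, `F = sgn ∘ C.eval`) in the Walsh basis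
(`Literature.NumberTheory.Sieve.GreenAC0.core_bound`, O'Donnell §1.4):
`|Σ G F| ≤ E₀ + (n+1)^k E₁ + 2ⁿ √τ`, where now BOTH `E₀` (the empty character) and `E₁` (the
characters of degree `1 ≤ |S| ≤ k`) are the uniform bound `E = 2^{n − n^c}` — so, unlike Green's
deduction from his Proposition 1, no prime number theorem and no `|S|`-dependence enter — and
`τ` is A. Tal's Fourier-tail bound for bounded-depth circuits (Tal 2017, Thm. 3.6, PROVED in the tree:
`ACForm.tailWeight_le_tailBound` through `Circuit.exists_acForm`, packaged as
`GreenAC0.tailWeight_circuit_le`), in place of Linial–Mansour–Nisan.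
Level: `k = ⌊n^c / (2(⌊log₂ n⌋ + 1))⌋`, so that `(n+1)^k ≤ 2^{n^c/2}` (`low_term_le`:
the small characters cost `≤ 2ⁿ · 2^{−n^c/2}`) while `k + 1 ≥ n^c/(2(⌊log₂ n⌋+1)) ≥ (2^c)^j/(2(j+1))`,
`j = ⌊log₂ n⌋`, beats every power of `⌊log₂(2p(n)+1)⌋ ≤ (deg p + 1)(j + 1)` (`tail_term_eventually`,
via `(j+1)^{d+1}/(2^c)^j → 0`).

What is NOT here: the hypothesis itself (crux `WalshLiouvilleBound`, item stmt-QuantumAdvantage-1390;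
the tree proves its twin `Literature.NumberTheory.Sieve.bourgain_liouville_walsh_holds`) and the
class glue `LiouvilleNotAC0` (item stmt-QuantumAdvantage-1396). Remark: the conclusion
`LiouvilleOrthogonalAC0` is also, up to the cast `((λ N : ℤ) : ℝ)`, the tree's PROVED
`Literature.NumberTheory.Sieve.green_liouville_AC0_holds` (Green's route through Proposition 1);
the present file is the route's own derivation from the uniform Walsh bound.

## References

* B. Green, *On (not) computing the Möbius function using bounded depth circuits*, Combin. Probab.
  Comput. 21 (2012) 942–951, §2 [Green2012].
* J. Bourgain, *Möbius–Walsh correlation bounds and an estimate of Mauduit and Rivat*, J. Anal.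
  Math. 119 (2013) 147–163, Theorem 1 [Bourgain2013MoebiusWalsh].
* A. Tal, *Tight bounds on the Fourier spectrum of AC⁰*, CCC 2017, Theorem 3.6 [Tal2017].
* R. O'Donnell, *Analysis of Boolean Functions*, CUP 2014, §1.4 [ODonnell2014].
-/

set_option linter.dupNamespace false -- D-0017: single-problem summit ⇒ `QuantumAdvantage.QuantumAdvantage` by design

noncomputable section

open Filter Finset Real Topology
open Literature.Computability.Complexity
open Literature.Computability.Complexity.LowDegree
open Literature.Computability.Complexity.ACForm
open Literature.Probability.RandomGraphs.LowDegree
open Literature.NumberTheory.Sieve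

namespace Summit.QuantumAdvantage.QuantumAdvantage.Theorems.MobiusLadder

/-! ### The dyadic size parameter `j = ⌊log₂ n⌋` -/

/-- `n + 1 ≤ 2^{⌊log₂ n⌋ + 1}` (in `ℝ`). [folklore] -/
theorem cast_succ_le_two_pow_log (n : ℕ) : (n : ℝ) + 1 ≤ (2 : ℝ) ^ (Nat.log 2 n + 1) := by
  have h : n + 1 ≤ 2 ^ (Nat.log 2 n + 1) := Nat.lt_pow_succ_log_self one_lt_two n
  exact_mod_cast h

/-- `(2^c)^{⌊log₂ n⌋} ≤ n^c` for `n ≥ 1`, `c ≥ 0` (since `2^{⌊log₂ n⌋} ≤ n`). [folklore] -/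
theorem rpow_pow_log_le {c : ℝ} (hc : 0 ≤ c) {n : ℕ} (hn : 1 ≤ n) :
    ((2 : ℝ) ^ c) ^ Nat.log 2 n ≤ (n : ℝ) ^ c := by
  calc ((2 : ℝ) ^ c) ^ Nat.log 2 n = ((2 : ℝ) ^ (Nat.log 2 n)) ^ c := by
        rw [← Real.rpow_natCast, ← Real.rpow_mul (by norm_num), mul_comm, Real.rpow_mul (by norm_num),
          Real.rpow_natCast]
    _ ≤ (n : ℝ) ^ c := by
        refine Real.rpow_le_rpow (by positivity) ?_ hc
        exact_mod_cast Nat.pow_log_le_self 2 (by omega)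

/-! ### The small characters: `(n+1)^k · 2^{n - n^c} ≤ 2ⁿ 2^{-n^c/2}` -/

/-- **Small characters.** If `(⌊log₂ n⌋ + 1) k ≤ n^c / 2` then
`(n+1)^k · 2^{n − n^c} ≤ 2ⁿ · 2^{−n^c/2}` (because `n + 1 ≤ 2^{⌊log₂ n⌋+1}`, so
`(n+1)^k ≤ 2^{(⌊log₂ n⌋+1)k} ≤ 2^{n^c/2}`). [cite: Green2012, §2] -/
theorem low_term_le {c : ℝ} (n k : ℕ) (hk : ((Nat.log 2 n : ℝ) + 1) * k ≤ (n : ℝ) ^ c / 2) :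
    ((n : ℝ) + 1) ^ k * (2 : ℝ) ^ ((n : ℝ) - (n : ℝ) ^ c) ≤ 2 ^ n * (2 : ℝ) ^ (-((n : ℝ) ^ c / 2)) := by
  have h1 : ((n : ℝ) + 1) ^ k ≤ (2 : ℝ) ^ ((n : ℝ) ^ c / 2) := by
    calc ((n : ℝ) + 1) ^ k ≤ ((2 : ℝ) ^ (Nat.log 2 n + 1)) ^ k :=
          pow_le_pow_left₀ (by positivity) (cast_succ_le_two_pow_log n) k
      _ = (2 : ℝ) ^ (((Nat.log 2 n + 1) * k : ℕ) : ℝ) := by rw [← pow_mul, Real.rpow_natCast]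
      _ ≤ (2 : ℝ) ^ ((n : ℝ) ^ c / 2) := by
          refine Real.rpow_le_rpow_of_exponent_le (by norm_num) ?_
          push_cast
          linarith
  calc ((n : ℝ) + 1) ^ k * (2 : ℝ) ^ ((n : ℝ) - (n : ℝ) ^ c)
      ≤ (2 : ℝ) ^ ((n : ℝ) ^ c / 2) * (2 : ℝ) ^ ((n : ℝ) - (n : ℝ) ^ c) :=
        mul_le_mul_of_nonneg_right h1 (by positivity)
    _ = 2 ^ n * (2 : ℝ) ^ (-((n : ℝ) ^ c / 2)) := by
        rw [← Real.rpow_add two_pos, ← Real.rpow_natCast, ← Real.rpow_add two_pos]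
        congr 1
        ring

/-- `2^{-n^c/2} ≤ η` eventually in `n` (`c, η > 0`). [folklore] -/
theorem two_rpow_neg_half_rpow_le_eventually {c η : ℝ} (hc : 0 < c) (hη : 0 < η) :
    ∀ᶠ n : ℕ in atTop, (2 : ℝ) ^ (-((n : ℝ) ^ c / 2)) ≤ η := by
  have h1 : Tendsto (fun n : ℕ => Real.log 2 * ((n : ℝ) ^ c / 2)) atTop atTop :=
    Tendsto.const_mul_atTop (Real.log_pos one_lt_two)
      (Tendsto.atTop_div_const two_pos ((tendsto_rpow_atTop hc).comp tendsto_natCast_atTop_atTop))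
  have h2 := Real.tendsto_exp_neg_atTop_nhds_zero.comp h1
  filter_upwards [h2.eventually (ge_mem_nhds hη)] with n hn
  have hn' : Real.exp (-(Real.log 2 * ((n : ℝ) ^ c / 2))) ≤ η := hn
  rw [Real.rpow_def_of_pos two_pos, mul_neg]
  exact hn'

/-! ### The tail: `tailBound (logM (2s)) (d+2) 1 (k+1) → 0` for polynomial `s` and `k + 1 ≳ n^c / log n` -/

/-- `⌊log₂(2 max(1, p(n)) + 1)⌋ ≤ (deg p + 1)(⌊log₂ n⌋ + 1)` for `n ≥ 2p(1) + 3`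
(from `2 max(1,p(n)) + 1 ≤ n^{deg p + 1}` and `n < 2^{⌊log₂ n⌋+1}`). [folklore] -/
theorem logM_le_mul_log (p : Polynomial ℕ) {n : ℕ} (hn : 2 * p.eval 1 + 3 ≤ n) :
    logM (2 * max 1 (p.eval n)) ≤ (p.natDegree + 1) * (Nat.log 2 n + 1) := by
  set E := p.natDegree + 1 with hE
  set j := Nat.log 2 n with hj
  have hM : 2 * max 1 (p.eval n) + 1 ≤ n ^ E := GreenAC0.two_mul_max_eval_succ_le p hn
  have hnj : n < 2 ^ (j + 1) := Nat.lt_pow_succ_log_self one_lt_two n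
  have hlt : 2 * max 1 (p.eval n) + 1 < 2 ^ (E * (j + 1)) := by
    calc 2 * max 1 (p.eval n) + 1 ≤ n ^ E := hM
      _ < (2 ^ (j + 1)) ^ E := Nat.pow_lt_pow_left hnj (by omega)
      _ = 2 ^ (E * (j + 1)) := by rw [← pow_mul, mul_comm]
  have := (Nat.log_lt_iff_lt_pow one_lt_two (by omega)).2 hlt
  unfold logM
  omega

/-- **The Fourier tail is eventually small.** For fixed depth `d`, size polynomial `p`, `c > 0` and
`ε > 0`: eventually in `n`, for every level `k` with `k + 1 ≥ n^c / (2(⌊log₂ n⌋ + 1))`,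
`tailBound (logM (2 max(1,p(n)))) (d+2) 1 (k+1) ≤ (ε/3)²`. With `j = ⌊log₂ n⌋`: `n^c ≥ (2^c)^j`,
`logM ≤ (deg p + 1)(j+1)`, and `(j+1)^{d+1}/(2^c)^j → 0`. [cite: Tal2017, Theorem 3.6] [cite: Green2012, §2] -/
theorem tail_term_eventually (d : ℕ) (p : Polynomial ℕ) {c ε : ℝ} (hc : 0 < c) (hε : 0 < ε) :
    ∀ᶠ n : ℕ in atTop, ∀ k : ℕ, (n : ℝ) ^ c / (2 * ((Nat.log 2 n : ℝ) + 1)) ≤ (k : ℝ) + 1 →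
      tailBound (logM (2 * max 1 (p.eval n))) (d + 2) 1 (k + 1) ≤ (ε / 3) ^ 2 := by
  set E : ℕ := p.natDegree + 1 with hE
  have hE0 : (0 : ℝ) < E := by rw [hE]; positivity
  set A : ℝ := (cA : ℝ) ^ (d + 2) with hA
  set B : ℝ := (cB : ℝ) ^ (d + 2) with hB
  have hA0 : 0 < A := by rw [hA]; unfold cA; positivity
  have hB0 : 0 < B := by rw [hB]; unfold cB B0; positivity
  set L : ℝ := Real.log (A / (ε / 3) ^ 2) with hL
  -- it suffices that the exponent is eventually `≥ L`
  suffices h : ∀ᶠ n : ℕ in atTop, ∀ k : ℕ, (n : ℝ) ^ c / (2 * ((Nat.log 2 n : ℝ) + 1)) ≤ (k : ℝ) + 1 →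
      L ≤ ((k + 1 : ℕ) : ℝ) * Real.log 2 /
        (B * ((1 : ℕ) : ℝ) * (logM (2 * max 1 (p.eval n)) : ℝ) ^ (d + 2 - 2)) by
    filter_upwards [h] with n hn k hk
    unfold tailBound
    have hexp := Real.exp_le_exp.2 (neg_le_neg (hn k hk))
    calc (cA : ℝ) ^ (d + 2) * Real.exp (-(((k + 1 : ℕ) : ℝ) * Real.log 2 /
            ((cB : ℝ) ^ (d + 2) * ((1 : ℕ) : ℝ) * (logM (2 * max 1 (p.eval n)) : ℝ) ^ (d + 2 - 2))))
        ≤ A * Real.exp (-L) := mul_le_mul_of_nonneg_left hexp hA0.le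
      _ = (ε / 3) ^ 2 := by
          rw [hL, Real.exp_neg, Real.exp_log (by positivity)]
          field_simp
  by_cases hL0 : L ≤ 0
  · exact Filter.Eventually.of_forall fun n k _ => hL0.trans (by positivity)
  push Not at hL0
  set r : ℝ := (2 : ℝ) ^ c with hr
  have hr1 : 1 < r := Real.one_lt_rpow one_lt_two hc
  have hr0 : 0 < r := one_pos.trans hr1
  have hl2 : 0 < Real.log 2 := Real.log_pos one_lt_two
  set κ : ℝ := Real.log 2 / (2 * L * B * (E : ℝ) ^ d) with hκ
  have hκ0 : 0 < κ := by rw [hκ]; positivity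
  -- eventually in `j`: `(j+1)^{d+1} / r^j ≤ κ`
  have hj : ∀ᶠ j : ℕ in atTop, ((j : ℝ) + 1) ^ (d + 1) / r ^ j ≤ κ := by
    have ht : Tendsto (fun j : ℕ => (((j + 1 : ℕ) : ℝ)) ^ (d + 1) / r ^ (j + 1)) atTop (𝓝 0) :=
      (tendsto_pow_const_div_const_pow_of_one_lt (d + 1) hr1).comp (tendsto_add_atTop_nat 1)
    have ht2 := ht.const_mul r
    rw [mul_zero] at ht2
    filter_upwards [ht2.eventually (ge_mem_nhds hκ0)] with j hj
    calc ((j : ℝ) + 1) ^ (d + 1) / r ^ j = r * ((((j + 1 : ℕ) : ℝ)) ^ (d + 1) / r ^ (j + 1)) := by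
          push_cast; rw [pow_succ r j]; field_simp
      _ ≤ κ := hj
  -- `⌊log₂ n⌋ → ∞`
  have hlog : Tendsto (fun n : ℕ => Nat.log 2 n) atTop atTop :=
    tendsto_atTop_atTop.2 fun J => ⟨2 ^ J, fun n hn => Nat.le_log_of_pow_le one_lt_two hn⟩
  filter_upwards [hlog.eventually hj, eventually_ge_atTop (2 * p.eval 1 + 3)] with n hjn hn k hk
  set j := Nat.log 2 n with hjdef
  set ℓ := logM (2 * max 1 (p.eval n)) with hℓ
  have hn1 : 1 ≤ n := by omega
  have hjn' : ((j : ℝ) + 1) ^ (d + 1) / r ^ j ≤ κ := hjn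
  have hℓE : ℓ ≤ E * (j + 1) := logM_le_mul_log p hn
  have hrj : r ^ j ≤ (n : ℝ) ^ c := rpow_pow_log_le hc.le hn1
  have hrj0 : 0 < r ^ j := pow_pos hr0 j
  have hjd : ((j : ℝ) + 1) ^ (d + 1) ≤ κ * r ^ j := by rwa [div_le_iff₀ hrj0] at hjn'
  have hℓ0 : (0 : ℝ) < ℓ := by
    have h1 : 1 ≤ 2 * max 1 (p.eval n) := by have := le_max_left 1 (p.eval n); omega
    exact_mod_cast one_le_logM h1
  have hj0 : (0 : ℝ) < (j : ℝ) + 1 := by positivity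
  have hk' : (n : ℝ) ^ c ≤ ((k : ℝ) + 1) * (2 * ((j : ℝ) + 1)) := by
    rwa [div_le_iff₀ (by positivity)] at hk
  rw [show d + 2 - 2 = d by omega, Nat.cast_one, mul_one, le_div_iff₀ (mul_pos hB0 (pow_pos hℓ0 d))]
  calc L * (B * (ℓ : ℝ) ^ d) ≤ L * (B * ((E : ℝ) * ((j : ℝ) + 1)) ^ d) := by
        gcongr
        exact_mod_cast hℓE
    _ = (L * B * (E : ℝ) ^ d) * ((j : ℝ) + 1) ^ (d + 1) / ((j : ℝ) + 1) := by
        rw [pow_succ, mul_pow]; field_simp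
    _ ≤ (L * B * (E : ℝ) ^ d) * (κ * r ^ j) / ((j : ℝ) + 1) := by gcongr
    _ = Real.log 2 / 2 * r ^ j / ((j : ℝ) + 1) := by rw [hκ]; field_simp
    _ ≤ Real.log 2 / 2 * (n : ℝ) ^ c / ((j : ℝ) + 1) := by gcongr
    _ ≤ Real.log 2 / 2 * (((k : ℝ) + 1) * (2 * ((j : ℝ) + 1))) / ((j : ℝ) + 1) := by gcongr
    _ = ((k + 1 : ℕ) : ℝ) * Real.log 2 := by push_cast; field_simp

/-! ### Green's §2 argument with a uniform Walsh bound -/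

/-- **Uniform Walsh bound ⇒ orthogonality to `AC⁰`** (Green 2012, §2, run with a hypothesis of
Bourgain's shape). Let `g : ℕ → ℝ`, `|g| ≤ 1`, and suppose that for some `c > 0`, for all large
`n` and EVERY `S ⊆ {0,…,n−1}`, `|Σ_{N<2ⁿ} g(N) w_S(bits N)| ≤ 2^{n − n^c}`. Then for every depth
`d`, size polynomial `p` and `ε > 0`, eventually in `n`, every circuit `C` over `acBasis` on `n`
inputs with `acDepth ≤ d` and `size ≤ p(n)` has `|Σ_{N<2ⁿ} g(N) sgn(C(bits N))| ≤ ε 2ⁿ`.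
Proof: reindex over the cube; `GreenAC0.core_bound` with `E₀ = E₁ = 2^{n−n^c}`,
`k = ⌊n^c/(2(⌊log₂ n⌋+1))⌋` and Tal's tail bound `GreenAC0.tailWeight_circuit_le`; then
`low_term_le`, `two_rpow_neg_half_rpow_le_eventually`, `tail_term_eventually`.
[cite: Green2012, §2] [cite: Tal2017, Theorem 3.6] -/
theorem ac0_orthogonal_of_uniform_walsh (g : ℕ → ℝ) (hg : ∀ m, |g m| ≤ 1) {c : ℝ} (hc : 0 < c)
    (hW : ∀ᶠ n : ℕ in atTop, ∀ S : Finset (Fin n),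
      |∑ N ∈ range (2 ^ n), g N * walsh S (fun i : Fin n => N.testBit i)| ≤
        (2 : ℝ) ^ ((n : ℝ) - (n : ℝ) ^ c))
    (d : ℕ) (p : Polynomial ℕ) {ε : ℝ} (hε : 0 < ε) :
    ∀ᶠ n : ℕ in atTop, ∀ C : Circuit (Fin n), C.IsOver acBasis → C.acDepth ≤ d →
      C.size ≤ p.eval n →
        |∑ N ∈ range (2 ^ n), g N * sgn (C.eval fun i : Fin n => N.testBit i)| ≤ ε * 2 ^ n := by
  have hε3 : 0 < ε / 3 := by positivity
  filter_upwards [hW, two_rpow_neg_half_rpow_le_eventually hc hε3, tail_term_eventually d p hc hε,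
    eventually_ge_atTop 1] with n hWn hsm htail hn1 C hCB hdepth hsize
  -- reindex over the cube `{0,1}ⁿ`
  rw [MoebiusWalsh.sum_range_two_pow_eq_sum_cube (fun x => g x * sgn (C.eval fun i => x.testBit i))]
  have hbits : ∀ y : Fin n → Bool, (fun i : Fin n => (bitsToNat (List.ofFn y)).testBit i) = y :=
    MoebiusWalsh.ofFn_testBit_bitsToNat
  simp only [hbits]
  -- the level `k`
  set j := Nat.log 2 n with hj
  set k : ℕ := ⌊(n : ℝ) ^ c / (2 * ((j : ℝ) + 1))⌋₊ with hk
  have hj0 : (0 : ℝ) < (j : ℝ) + 1 := by positivity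
  have hq0 : 0 ≤ (n : ℝ) ^ c / (2 * ((j : ℝ) + 1)) := by positivity
  have hk_le : (k : ℝ) ≤ (n : ℝ) ^ c / (2 * ((j : ℝ) + 1)) := Nat.floor_le hq0
  have hk_lt : (n : ℝ) ^ c / (2 * ((j : ℝ) + 1)) ≤ (k : ℝ) + 1 := (Nat.lt_floor_add_one _).le
  have hjk : ((j : ℝ) + 1) * k ≤ (n : ℝ) ^ c / 2 := by
    rw [le_div_iff₀ (by positivity)] at hk_le
    linarith
  -- the size parameter `s ≥ 1`
  set s := max 1 (p.eval n) with hs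
  have hs1 : 1 ≤ s := le_max_left _ _
  have hsize' : C.size ≤ s := hsize.trans (le_max_right _ _)
  have hf : ∀ y : Fin n → Bool, |sgn (C.eval y)| ≤ 1 := fun y => by
    unfold sgn; split_ifs <;> simp
  -- the uniform Walsh bound on the cube
  set E : ℝ := (2 : ℝ) ^ ((n : ℝ) - (n : ℝ) ^ c) with hEdef
  have hE0 : 0 < E := by rw [hEdef]; positivity
  have hWalsh : ∀ S : Finset (Fin n),
      |∑ y : Fin n → Bool, g (bitsToNat (List.ofFn y)) * walsh S y| ≤ E := by
    intro S
    have h := hWn S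
    rw [MoebiusWalsh.sum_range_two_pow_eq_sum_cube (fun x => g x * walsh S fun i => x.testBit i)] at h
    simp only [hbits] at h
    exact h
  have h0 : |∑ y : Fin n → Bool, g (bitsToNat (List.ofFn y))| ≤ E := by
    have := hWalsh ∅
    simpa only [GreenAC0.walsh_empty, mul_one] using this
  have hcore := GreenAC0.core_bound (k := k) (fun y => sgn (C.eval y))
    (fun y => g (bitsToNat (List.ofFn y))) hf (fun y => hg _) (E₀ := E) (E₁ := E)
    (τ := tailBound (logM (2 * s)) (d + 2) 1 (k + 1)) hE0.le h0 (fun S _ _ => hWalsh S)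
    (GreenAC0.tailWeight_circuit_le C hCB hdepth hsize' hs1 (k + 1))
  refine hcore.trans ?_
  -- the three terms are each `≤ (ε/3) 2ⁿ`
  have h2n : (0 : ℝ) < 2 ^ n := by positivity
  have hlow : ((n : ℝ) + 1) ^ k * E ≤ ε / 3 * 2 ^ n := by
    calc ((n : ℝ) + 1) ^ k * E ≤ 2 ^ n * (2 : ℝ) ^ (-((n : ℝ) ^ c / 2)) := low_term_le n k hjk
      _ ≤ 2 ^ n * (ε / 3) := mul_le_mul_of_nonneg_left hsm h2n.le
      _ = ε / 3 * 2 ^ n := by ring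
  have hE : E ≤ ε / 3 * 2 ^ n := by
    have h1 : (1 : ℝ) ≤ ((n : ℝ) + 1) ^ k := one_le_pow₀ (by linarith [(n.cast_nonneg : (0 : ℝ) ≤ n)])
    calc E = 1 * E := (one_mul E).symm
      _ ≤ ((n : ℝ) + 1) ^ k * E := mul_le_mul_of_nonneg_right h1 hE0.le
      _ ≤ ε / 3 * 2 ^ n := hlow
  have hsqrt : Real.sqrt (tailBound (logM (2 * s)) (d + 2) 1 (k + 1)) ≤ ε / 3 := by
    rw [← Real.sqrt_sq hε3.le]
    exact Real.sqrt_le_sqrt (htail k hk_lt)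
  have := mul_le_mul_of_nonneg_left hsqrt h2n.le
  linarith

/-! ### The item -/

/-- **Settles `stmt-QuantumAdvantage-1395`** (route MobiusLadder, support `AC0Rung`, rung R0):
`WalshLiouvilleBound → LiouvilleOrthogonalAC0` — Bourgain's uniform Liouville–Walsh bound
`|Σ_{N<2ⁿ} λ(N) w_S(bits N)| ≤ 2^{n−n^c}` (all `S`, `n` large) implies that `λ` is asymptotically
orthogonal to every polynomial-size `AC⁰` function of the binary digits, by Green's §2 argument with
Tal's Fourier-tail bound (`ac0_orthogonal_of_uniform_walsh` at `g = λ`, `|λ| ≤ 1`).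
[cite: Green2012, §2] [cite: Bourgain2013MoebiusWalsh, Theorem 1] [cite: Tal2017, Theorem 3.6] -/
theorem AC0Rung_proof : Summit.QuantumAdvantage.QuantumAdvantage.Theses.MobiusLadder.AC0Rung := by
  unfold Summit.QuantumAdvantage.QuantumAdvantage.Theses.MobiusLadder.AC0Rung
    Summit.QuantumAdvantage.QuantumAdvantage.Theses.MobiusLadder.WalshLiouvilleBound
    Summit.QuantumAdvantage.QuantumAdvantage.Theses.MobiusLadder.LiouvilleOrthogonalAC0
  rintro ⟨c, hc, hW⟩ d p ε hε
  exact ac0_orthogonal_of_uniform_walsh (fun N => ((ArithmeticFunction.liouville N : ℤ) : ℝ))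
    (fun m => Literature.NumberTheory.LFunctions.LiouvilleSum.abs_liouville_le_one m) hc hW d p hε

end Summit.QuantumAdvantage.QuantumAdvantage.Theorems.MobiusLadder

end
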